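import Mathlib
import Summits.Ventures.PercRepro2.SwOutMixedArmsBaseMovesPlus
import Summits.Ventures.PercRepro2.SwOutMixedArmsBaseLeak
import Summits.Ventures.PercRepro2.SwOutMixedArmsPlusThm

/-!
# THE BLOCK THEOREM OF A JUNCTION WITH SEVERAL MIXED ARMS (blind cell PercRepro2, night-4 g21,
2026-08-27; proofs/NIGHT4-G21.md §6)

**Theorem** `MixedBaseR.rigid_block_plus`: for a several-arms base (u-arms `U j` joined to `u`,
dropped vertices `p r` joined to `u` with their outside edges, pieces `Ah i` of the h-pieces joined
to `p (arm i)` by dead edges, far arms `F k`, the base colouring `σ`), whose region `Us` contains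
`h`, `u`, the `p r` and the arms and not `l`, with every edge class non-empty, the BLOCK
`C = mixedRealR '' {¬ Leak}` satisfies the rigid counting inequality of (SW) on `C ∩ tgtU` for
every up-set `𝓔` of edge sets: `#{ζ ∈ C ∩ Q : redEdges ζ h ∈ 𝓔} ≤ #{ζ ∈ C ∩ Q : blueEdges ζ h ∈ 𝓔}`.

Proof: the edge-set interface `card_le_of_mixedArmsPlus_edges` (the abstract big-block lemma
under AL⁺) with `r = mixedRealR` — injective (`mixedRealR_injective`), the closure of the
pulled-back conditioning under AL⁺ (`mem_tgtU_of_lePlus`), the abstract leak being the pair of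
hull-formula hypotheses (`not_leak_iff_RB`), and the edge-set forms of the hull formulas
(`redEdges_mixedRealR` / `blueEdges_mixedRealR`) with the monotone edge map `φR`.  This is
boundaries (i)–(iii) of Theorem A_mix (NIGHT4-G19.md §5′) at the geometric level: several arms,
pure arms among them, any number of pieces per arm.
-/

namespace Summit.Ventures.PercRepro2

namespace MixedArms

open Hull LocRows BigBlock

open scoped Classical

variable {V : Type*} {E : Type*}

section BlockPlus

variable {ι ρ ν κ : Type*} [Nonempty ι] [Fintype ι] [DecidableEq ι] [Fintype ρ]
  [DecidableEq ρ] [Fintype ν] [DecidableEq ν] [Fintype κ] [DecidableEq κ] [Fintype E]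
  [DecidableEq E] {ends : E → Sym2 V} {σ : Config E} {h u : V} {U : ι → Set V} {p : ρ → V}
  {Ah : ν → Set V} {arm : ν → ρ} {F : κ → Set V}

/-- The block of a several-arms base: the realisations of the non-leaking points. -/
noncomputable def blockCRP (ends : E → Sym2 V) (σ : Config E) (u : V) (U : ι → Set V) (p : ρ → V)
    (Ah : ν → Set V) (arm : ν → ρ) (F : κ → Set V) : Finset (Config E) :=
  (Finset.univ.filter fun q : PtR ι ρ ν κ => ¬ Leak q arm).image (mixedRealR ends u U p Ah F σ)

variable (hb : MixedBaseR ends σ h u U p Ah arm F)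
include hb

/-- **THE BLOCK THEOREM OF A JUNCTION WITH SEVERAL MIXED ARMS**: the rigid counting inequality on
the block of a several-arms base, pieces allowed, for every up-set of edge sets. -/
theorem MixedBaseR.rigid_block_plus (hup : ∀ r, ∃ e, ends e = s(u, p r))
    (hAe : ∀ i, ∃ e, e ∈ touches ends (Ah i)) (hFe : ∀ k, ∃ e, e ∈ touches ends (F k))
    (hext : ∀ r, ∃ e, e ∈ clsExtR ends u p Ah r) {Us : Set V} {l o : V}
    (hUs : {h} ∪ {u} ∪ Set.range p ∪ armsAllR U Ah F ⊆ Us) (hl : l ∉ Us)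
    {𝓔 : Set (Set E)} (h𝓔 : IsUpperSet 𝓔) :
    ((blockCRP ends σ u U p Ah arm F).filter fun ζ =>
        ζ ∈ (tgtU ends l h {S : Set V | o ∈ S} : Set (Config E)) ∧ redEdges ends ζ h ∈ 𝓔).card ≤
      ((blockCRP ends σ u U p Ah arm F).filter fun ζ =>
        ζ ∈ (tgtU ends l h {S : Set V | o ∈ S} : Set (Config E)) ∧
          blueEdges ends ζ h ∈ 𝓔).card := by
  have hinj := hb.mixedRealR_injective hup hAe hFe hext
  have hC : ∀ ζ, ζ ∈ blockCRP ends σ u U p Ah arm F ↔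
      ∃ q, ¬ Leak q arm ∧ mixedRealR ends u U p Ah F σ q = ζ := by
    intro ζ
    simp only [blockCRP, Finset.mem_image, Finset.mem_filter, Finset.mem_univ, true_and]
  have hEv : ArmLowerPlus arm {q : PtR ι ρ ν κ |
      mixedRealR ends u U p Ah F σ q ∈ (tgtU ends l h {S : Set V | o ∈ S} : Set (Config E))} := by
    intro q q' hq hq' hs ha he hf huP hQ
    rw [not_leak_iff_RB] at hq hq'
    exact hb.mem_tgtU_of_lePlus hup hUs hl hs ha he hf hq.1 hq'.2 hq'.1 huP hQ
  have hR : ∀ q : PtR ι ρ ν κ, ¬ Leak q arm →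
      redEdges ends (mixedRealR ends u U p Ah F σ q) h = φR ends σ h u U p Ah F (ER q) := by
    intro q hq
    rw [not_leak_iff_RB] at hq
    exact hb.redEdges_mixedRealR hup hq.1
  have hB : ∀ q : PtR ι ρ ν κ, ¬ Leak q arm →
      blueEdges ends (mixedRealR ends u U p Ah F σ q) h = φR ends σ h u U p Ah F (EB q) := by
    intro q hq
    rw [not_leak_iff_RB] at hq
    exact hb.blueEdges_mixedRealR hup hq.2
  have key := card_le_of_mixedArmsPlus_edges (ends := ends) (mixedRealR ends u U p Ah F σ)
    (fun q q' _ _ hqq => hinj hqq) (blockCRP ends σ u U p Ah arm F) hC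
    (tgtU ends l h {S : Set V | o ∈ S} : Set (Config E)) hEv h (φR ends σ h u U p Ah F)
    (φR_mono ends σ h u U p Ah F) hR hB h𝓔
  convert key using 2 <;> congr

end BlockPlus

end MixedArms

end Summit.Ventures.PercRepro2
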